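import Literature.NumberTheory.EllipticCurves.TowerConnectingKernelLiftableProofs
import Literature.NumberTheory.EllipticCurves.ZpExtensionEisensteinResidualKernelProofs
import HarnessLib

/-!
# (Ker) for the local Eisenstein tower: classes of `H¹(K_w, W_k)` killed by `H¹(×p^d)` lie in the bottom level
# condition of Howard's `F_𝔮` tower at `w` (theorems only)

`Proofs` file (theorems only; no definition, no named fact, no instance, no `sorry`).  Topic `NumberTheory/EllipticCurves`
(D1 road of cell `pub/bsd-print-x9`, LEAD `bsd-line-x10b-p1` g8, (H4-KER)); the Eisenstein instantiation of
`Tower.ker_map_up_le_levelCondition_bot` (`TowerConnectingKernelLiftableProofs`) in the hfin4 CURRENCY fixed on the cell's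
STATUS (19:04Z): `X_j := H¹(K_w, W_j)`, `W_j = M_j ⊗ A_{m,j}(ψ)` (`κ.eisensteinTwist (ρ j) hm j` localised at the finite
place `w`), `red := κ.eisensteinLocalReduce ρ t hm (Sum.inr w)`, the upward maps `×p^d : W_k ↪ W_{k+d}` being the
two-index family `κ.eisensteinTwistTransfer ρ t hm ht hkt hkill k (k+d)` (`ZpExtensionEisensteinTowerDivisionProofs`):

* **`ZpExtension.ker_map_eisensteinTwistTransfer_le_levelCondition_bot`** —
  `ker H¹(K_w, ×p^d) ≤ Tower.levelCondition red p ⊥ k` — the `hKer` input of the (Dual) step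
  (`Tower.mem_levelCondition_top_of_forall_pairing_bot_eq_zero_of_range`, x9-p1-w4 g5 p659369) of Howard's H.4 for `F_𝔮`
  at the places `w ∈ Σ`; with x9-p1-w2 g7's `levelCondition_eisensteinLocalReduce_succ` (p660339) it is read on the
  `D`-indexed tower `H¹(K_w, T^{(j)})`, `T^{(j)} = W_{j+1}`.
The identities `hid/hcomp/hsq/hinj/hsurj/hex/hkill` of the localised family are those recorded in
`ZpExtensionEisensteinResidualKernelProofs` (x9-p1-w3 g5).  No summit statement is proved; BSD is not proved by any of this.

References: B. Howard, Compositio Math. 140 (2004), Def. 1.1.3, §1.3 H.4, §2.2, Def. 3.2.6 (arXiv:1202.6340 p. 5, p. 7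
L69–82, p. 16); J.-P. Serre, *Galois Cohomology* (1997), I §2.2, II §1.
-/

set_option autoImplicit false

noncomputable section

open Function NumberField IsDedekindDomain Field
open scoped NumberField ContRepresentation TensorProduct Classical

namespace Literature.NumberTheory.EllipticCurves.ZpExtension

open Literature.NumberTheory.GaloisRepresentations IwasawaAlgebra
open Literature.NumberTheory.GaloisCohomology.Howard2004

variable {K : Type} [Field K] [NumberField K] {p : ℕ} [hp : Fact p.Prime] (κ : ZpExtension K p)
  {M : ℕ → Type} [∀ k, AddCommGroup (M k)] [∀ k, TopologicalSpace (M k)] [∀ k, DiscreteTopology (M k)]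
  (ρ : ∀ k, DiscreteGaloisModule K (M k))
  (t : ∀ k, (ρ (k + 1)).toContRepresentation →ⁱL (ρ k).toContRepresentation) {m : ℕ} (hm : 1 ≤ m)

/-- **(Ker) for the local Eisenstein tower.**  For a generic Eisenstein tower (`ht/hkt/hkill`, coordinates `e`) and a
finite place `w`, a class of `H¹(K_w, W_k)` killed by `H¹(K_w, ×p^d : W_k ↪ W_{k+d})` is the level-`k` component of a
`p^d`-torsion compatible family of the local tower, i.e. lies in `Tower.levelCondition (eisensteinLocalReduce … w) p ⊥ k`
(the connecting classes `δ₀^{(j,d)} u` of an invariant `u ∈ H⁰(K_w, W_d)`).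
[cite: Howard2004HeegnerKolyvagin, §1.3 H.4 and Def. 3.2.6 (arXiv p. 7 L78–82, p. 16)] [cite: SerreGaloisCohomology1997, Ch. I §2.2] -/
theorem ker_map_eisensteinTwistTransfer_le_levelCondition_bot (ht : ∀ k, Function.Surjective (t k))
    (hkt : ∀ k (x : M (k + 1)), t k x = 0 ↔ ∃ y : M (k + 1), x = ((p : ℤ) ^ k) • y)
    (hkill : ∀ k (x : M k), ((p : ℤ) ^ k) • x = 0) {ι : ℕ → Type} [∀ k, Fintype (ι k)]
    (e : ∀ k, M k ≃+ (ι k → ZMod (p ^ k))) (w : HeightOneSpectrum (𝓞 K)) (k d : ℕ) :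
    (galoisCohomology.map (DiscreteGaloisModule.localMap (κ.eisensteinTwistTransfer ρ t hm ht hkt hkill k (k + d))
        (Sum.inr w)) 1).ker ≤
      Tower.levelCondition (κ.eisensteinLocalReduce ρ t hm (Sum.inr w)) p
        (fun j ↦ (⊥ : AddSubgroup (galoisCohomology ((κ.eisensteinTwist (ρ j) hm j).toLocal (Sum.inr w)) 1))) k := by
  -- the two-index family, localised at `w`, and its identities (as in `propagate_eisensteinSelmerStructure_one_eq_ker`)
  let Fam : ∀ a b, (κ.eisensteinTwist (ρ a) hm a).toContRepresentation →ⁱL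
      (κ.eisensteinTwist (ρ b) hm b).toContRepresentation :=
    fun a b ↦ κ.eisensteinTwistTransfer ρ t hm ht hkt hkill a b
  let ρloc : ∀ j, DiscreteGaloisModule (w.adicCompletion K) (EisensteinLevel p m M j) :=
    fun j ↦ ((κ.eisensteinTwist (ρ j) hm j : DiscreteGaloisModule K (EisensteinLevel p m M j))).toLocal (Sum.inr w)
  let floc : ∀ a b, (ρloc a).toContRepresentation →ⁱL (ρloc b).toContRepresentation :=
    fun a b ↦ DiscreteGaloisModule.localMap (Fam a b) (Sum.inr w)
  have hid : ∀ a (x : EisensteinLevel p m M a), floc a a x = x :=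
    fun a x ↦ κ.eisensteinTwistTransfer_self ρ t hm ht hkt hkill a x
  have hcomp : ∀ a b c', c' ≤ b → b ≤ a → ∀ x : EisensteinLevel p m M a, floc b c' (floc a b x) = floc a c' x :=
    fun a b c' hcb hba x ↦ κ.eisensteinTwistTransfer_comp ρ t hm ht hkt hkill hcb hba x
  have hsq : ∀ a b, a ≤ b → ∀ x : EisensteinLevel p m M (a + 1),
      floc a b (floc (a + 1) a x) = floc (b + 1) b (floc (a + 1) (b + 1) x) :=
    fun a b hab x ↦ κ.eisensteinTwistTransfer_sq ρ t hm ht hkt hkill hab x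
  have hinj : ∀ ℓ n, Function.Injective (floc ℓ (ℓ + n)) :=
    fun ℓ n ↦ κ.eisensteinTwistTransfer_injective_of_le ρ t hm ht hkt hkill e ℓ n
  have hsurj : ∀ ℓ n, Function.Surjective (floc (ℓ + n) n) :=
    fun ℓ n ↦ κ.eisensteinTwistTransfer_surjective_of_le ρ t hm ht hkt hkill (Nat.le_add_left n ℓ)
  have hex : ∀ ℓ n (y : EisensteinLevel p m M (ℓ + n)), floc (ℓ + n) n y = 0 ↔ ∃ x, floc ℓ (ℓ + n) x = y :=
    fun ℓ n y ↦ κ.eisensteinTwistTransfer_eq_zero_iff_exists ρ t hm ht hkt hkill ℓ n y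
  have hkill' : ∀ j (x : EisensteinLevel p m M j), p ^ j • x = 0 := fun j x ↦ EisensteinCoeff.prime_pow_nsmul_twisted x
  -- D1's local tower is `H¹(floc (j+1) j)`
  have hred : κ.eisensteinLocalReduce ρ t hm (Sum.inr w) = fun j ↦ galoisCohomology.map (floc (j + 1) j) 1 := by
    funext j
    change _ = galoisCohomology.map (DiscreteGaloisModule.localMap
      (κ.eisensteinTwistTransfer ρ t hm ht hkt hkill (j + 1) j) (Sum.inr w)) 1
    rw [κ.eisensteinTwistTransfer_succ_self ρ t hm ht hkt hkill j]
    rfl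
  rw [hred]
  exact Tower.ker_map_up_le_levelCondition_bot ρloc floc hid hcomp hsq hinj hsurj hex p hkill' k d

end Literature.NumberTheory.EllipticCurves.ZpExtension

end
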